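import Literature.NumberTheory.Transcendental.NesterenkoGenericDegree
import Literature.NumberTheory.Transcendental.NesterenkoGenericPoints
import Literature.NumberTheory.Transcendental.NesterenkoUResultantHeight
import Literature.NumberTheory.Transcendental.PhilipponCriterionProjDist
import Literature.NumberTheory.Transcendental.RoySmallValueLinearFactorsFintype
import Literature.NumberTheory.Transcendental.RoySmallValueEstimatesAbsHeightProofs
import Mathlib.RingTheory.Nullstellensatz
import Mathlib.NumberTheory.NumberField.InfinitePlace.Embeddings
import HarnessLib

/-!
# The 0-dimensional dictionary, I: zeros of a rank-1 homogeneous prime and the field of a normalised zero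

Crux `stmt-Schanuel-6117` (`Summit.Schanuel.Schanuel.Theses.DiophantineDichotomy.ApproximationProperty`),
line `orbit-interpolation-determinant`, registered stub `stub_zeroDimDictionary : ZeroDimDictionary`
(the structure of a homogeneous prime `𝔭 ⊂ ℚ[x₀, …, x_m]` of rank `1` — a Galois orbit of points of
`ℙᵐ` — in Nesterenko's elimination language; proved in
`DiophantineDichotomyApproximationPropertyZeroDimDictionary.lean`, which imports this file through
`…Degree` and `…Value`). Everything here is PROVED (no definitions, no named facts):

* `chowForm_facts`, `oneBlock_facts`, `eval_oneBlock_eq_zero_iff`, `exists_split_oneBlock` — the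
  associated form `F = chowForm 𝔭 1 ∈ ℚ[u₀, …, u_m]` (Prop. 4.4: `p̄(1) = (F)`, `F` prime of degree
  `deg 𝔭 ≥ 1`) read as the complex form `g = F(x₀, …, x_m)`; its zeros are the hyperplanes through
  the points of `V(𝔭)`, so `g = c ∏_{i<deg 𝔭} ℓ_{β̄ᵢ}` with `β̄ᵢ ∈ V(𝔭)`, and every zero of `𝔭` is
  proportional to a point of any such splitting (`exists_eq_smul_of_split`);
* `apply_ne_zero_of_mem_projZeros` — no zero of `𝔭` lies on `x_j = 0` when `x_j ∉ 𝔭`;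
* `isIntegral_of_mem_projZeros`, `numberField_adjoin` — the coordinates of a normalised zero `b̄'`
  (`b'_j = 1`) are algebraic, so `K = ℚ(b̄') ⊆ ℂ` is a number field;
* `stub_zeroDimDictionary_zeros` — the registered sub-goal of this file.

Sources: Nesterenko, LNM 1752 Ch. 3 §4 (Prop. 4.4, Def. 4.6), §5; Philippon 1986 §1; Hodge–Pedoe
II Ch. X §§6–8 (the Cayley form of a 0-cycle).
-/

noncomputable section

-- `Summit.Schanuel.Schanuel.…` is the mandated summit/sub-problem namespace (single-conjunct summit), hence:
set_option linter.dupNamespace false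

namespace Summit.Schanuel.Schanuel.Cruxes.ApproximationProperty.OrbitInterpolationDeterminant

open Literature.NumberTheory.Transcendental.Nesterenko MvPolynomial
open scoped BigOperators

variable {m : ℕ}

/-! ## §1  Rank-one primes: the associated form in one block of variables -/

section RankOne

variable {𝔭 : Ideal (Rx m)}

/-- A prime which is unmixed of rank `1` has `dim ℚ[x̲]/𝔭 = 1` (it is its own associated prime).
[folklore] -/
theorem rank_eq_one (h𝔭 : 𝔭.IsPrime) (hunm : IsUnmixedOfRank 𝔭 1) :
    ringKrullDim (Rx m ⧸ 𝔭) = (1 : ℕ) := by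
  refine hunm.2 𝔭 ⟨h𝔭, 1, ?_⟩
  have hcol : Submodule.colon 𝔭 {(1 : Rx m)} = 𝔭 := by
    ext a; rw [Submodule.mem_colon_singleton, smul_eq_mul, mul_one]
  rw [hcol, h𝔭.radical]

/-- The same, in the form `dim = s + 1` with `s = 0`. [folklore] -/
theorem rank_eq_zero_add_one (h𝔭 : 𝔭.IsPrime) (hunm : IsUnmixedOfRank 𝔭 1) :
    ringKrullDim (Rx m ⧸ 𝔭) = ((0 + 1 : ℕ) : ℕ) := by
  rw [rank_eq_one h𝔭 hunm]

/-- For a homogeneous prime of rank `1`: `p̄(1)` is principal, generated by the associated form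
`F = chowForm 𝔭 1 ≠ 0`, which is prime, of degree `deg 𝔭 ≥ 1`, and homogeneous of that degree.
[cite: NesterenkoPhilippon2001, Ch. 3 Prop. 4.4 (p. 38)] -/
theorem chowForm_facts (h𝔭 : 𝔭.IsPrime)
    (hhom : letI := MvPolynomial.gradedAlgebra (σ := Fin (m + 1)) (R := ℚ);
      𝔭.IsHomogeneous (homogeneousSubmodule (Fin (m + 1)) ℚ)) (hunm : IsUnmixedOfRank 𝔭 1) :
    (elimIdeal 𝔭 1).IsPrincipal ∧ chowForm 𝔭 1 ≠ 0 ∧ Prime (chowForm 𝔭 1) ∧ 1 ≤ ideg 𝔭 1 ∧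
      (chowForm 𝔭 1).IsHomogeneous (ideg 𝔭 1) ∧ chowForm 𝔭 1 ∈ elimIdeal 𝔭 1 := by
  haveI := h𝔭
  have hdim := rank_eq_one h𝔭 hunm
  have hpr : (elimIdeal 𝔭 1).IsPrincipal := isPrincipal_elimIdeal_of_isPrime h𝔭 hhom le_rfl hdim
  have hprime : Prime (chowForm 𝔭 1) := prime_chowForm 𝔭 hhom le_rfl hdim
  have hdeg : 1 ≤ ideg 𝔭 1 := one_le_ideg_of_irreducible_chowForm Nat.one_pos hprime.irreducible
  have hFhom : (chowForm 𝔭 1).IsHomogeneous (ideg 𝔭 1) := fun γ hγ => by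
    have h := degree_eq_of_mem_support_chowForm 𝔭 Nat.one_pos (mem_support_iff.mpr hγ)
    rw [Finsupp.degree_eq_weight_one, one_mul] at h
    exact h
  have hmem : chowForm 𝔭 1 ∈ elimIdeal 𝔭 1 := by
    rw [← span_chowForm 𝔭 1 hpr]
    exact Ideal.mem_span_singleton_self _
  exact ⟨hpr, hprime.ne_zero, hprime, hdeg, hFhom, hmem⟩

/-- Evaluating the one-block complex form `g = F(x₀, …, x_m)` of `F ∈ ℚ[u₀, …, u_m]`. [folklore] -/
theorem eval_oneBlock (F : RU 1 m) (u : Fin (m + 1) → ℂ) :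
    eval u (rename Prod.snd (map (algebraMap ℚ ℂ) F)) =
      aeval (fun v : Fin 1 × Fin (m + 1) => u v.2) F := by
  rw [eval_rename, eval_map, aeval_def]
  rfl

/-- `ℂ`-algebra evaluations of the one-block form are evaluations of `F`. [folklore] -/
theorem aeval_oneBlock {A : Type*} [CommRing A] [Algebra ℂ A] (F : RU 1 m) (u : Fin (m + 1) → A) :
    aeval u (rename Prod.snd (map (algebraMap ℚ ℂ) F)) =
      aeval (fun v : Fin 1 × Fin (m + 1) => u v.2) (map (algebraMap ℚ ℂ) F) := by
  rw [aeval_rename]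
  rfl

/-- `Prod.snd : Fin 1 × X → X` is injective. [folklore] -/
theorem snd_injective_fin_one {X : Type*} : Function.Injective (Prod.snd : Fin 1 × X → X) :=
  fun _ _ h => Prod.ext (Subsingleton.elim _ _) h

/-- The one-block form of a non-zero `F` is non-zero, has the same `|·|`, and is a form of degree
`deg 𝔭` when `F = chowForm 𝔭 1`. [folklore] -/
theorem oneBlock_facts (h𝔭 : 𝔭.IsPrime)
    (hhom : letI := MvPolynomial.gradedAlgebra (σ := Fin (m + 1)) (R := ℚ);
      𝔭.IsHomogeneous (homogeneousSubmodule (Fin (m + 1)) ℚ)) (hunm : IsUnmixedOfRank 𝔭 1) :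
    rename Prod.snd (map (algebraMap ℚ ℂ) (chowForm 𝔭 1)) ≠ 0 ∧
      maxNorm (rename Prod.snd (map (algebraMap ℚ ℂ) (chowForm 𝔭 1))) = maxNorm (chowForm 𝔭 1) ∧
      (rename Prod.snd (map (algebraMap ℚ ℂ) (chowForm 𝔭 1))).IsHomogeneous (ideg 𝔭 1) ∧
      (rename Prod.snd (map (algebraMap ℚ ℂ) (chowForm 𝔭 1))).totalDegree = ideg 𝔭 1 := by
  obtain ⟨-, hF0, -, -, hFhom, -⟩ := chowForm_facts h𝔭 hhom hunm
  have hmap0 : map (algebraMap ℚ ℂ) (chowForm 𝔭 1) ≠ 0 :=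
    (map_ne_zero_iff _ (map_injective _ (algebraMap ℚ ℂ).injective)).mpr hF0
  have hg0 : rename Prod.snd (map (algebraMap ℚ ℂ) (chowForm 𝔭 1)) ≠ 0 :=
    (map_ne_zero_iff _ (rename_injective _ snd_injective_fin_one)).mpr hmap0
  have hghom : (rename Prod.snd (map (algebraMap ℚ ℂ) (chowForm 𝔭 1))).IsHomogeneous (ideg 𝔭 1) :=
    (hFhom.map (algebraMap ℚ ℂ)).rename_isHomogeneous
  refine ⟨hg0, ?_, hghom, hghom.totalDegree hg0⟩
  rw [maxNorm_rename_of_injective snd_injective_fin_one, maxNorm_map_algebraMap]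

/-- **Zeros of the one-block form**: `g(u) = 0` iff the hyperplane `u` passes through a point of
`V(𝔭)`. [cite: NesterenkoPhilippon2001, Ch. 3 Prop. 4.4 (p. 38)] -/
theorem eval_oneBlock_eq_zero_iff (h𝔭 : 𝔭.IsPrime)
    (hhom : letI := MvPolynomial.gradedAlgebra (σ := Fin (m + 1)) (R := ℚ);
      𝔭.IsHomogeneous (homogeneousSubmodule (Fin (m + 1)) ℚ)) (hunm : IsUnmixedOfRank 𝔭 1)
    (u : Fin (m + 1) → ℂ) :
    eval u (rename Prod.snd (map (algebraMap ℚ ℂ) (chowForm 𝔭 1))) = 0 ↔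
      ∃ β ∈ projZeros 𝔭, ∑ j, β j * u j = 0 := by
  obtain ⟨hpr, -⟩ := chowForm_facts h𝔭 hhom hunm
  rw [eval_oneBlock, aeval_chowForm_eq_zero_iff hhom hpr]
  simp only [forall_const]
  constructor
  · rintro ⟨β, hβ, h⟩
    exact ⟨β, hβ, by rw [← h]; exact Finset.sum_congr rfl fun j _ => mul_comm _ _⟩
  · rintro ⟨β, hβ, h⟩
    exact ⟨β, hβ, by rw [← h]; exact Finset.sum_congr rfl fun j _ => mul_comm _ _⟩

/-- **Splitting of the one-block form**: `g = c ∏_{i < deg 𝔭} ℓ_{β̄ᵢ}` over `ℂ` with `c ≠ 0` and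
`β̄ᵢ ∈ V(𝔭)`. [cite: NesterenkoPhilippon2001, Ch. 3 Prop. 4.4 (p. 38)] -/
theorem exists_split_oneBlock (h𝔭 : 𝔭.IsPrime)
    (hhom : letI := MvPolynomial.gradedAlgebra (σ := Fin (m + 1)) (R := ℚ);
      𝔭.IsHomogeneous (homogeneousSubmodule (Fin (m + 1)) ℚ)) (hunm : IsUnmixedOfRank 𝔭 1) :
    ∃ c : ℂ, c ≠ 0 ∧ ∃ β : Fin (ideg 𝔭 1) → (Fin (m + 1) → ℂ), (∀ i, β i ∈ projZeros 𝔭) ∧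
      rename Prod.snd (map (algebraMap ℚ ℂ) (chowForm 𝔭 1)) = C c * ∏ i, (∑ j, C (β i j) * X j) := by
  obtain ⟨hg0, -, -, hdeg⟩ := oneBlock_facts h𝔭 hhom hunm
  have hW0 : ∀ β ∈ projZeros 𝔭, β ≠ 0 := fun β hβ => hβ.1
  obtain ⟨c, hc, β, hβ, heq⟩ := exists_eq_C_mul_prod_linC hg0 hW0
    (fun β hβ u hu => (eval_oneBlock_eq_zero_iff h𝔭 hhom hunm u).mpr ⟨β, hβ, hu⟩)
    (fun u hu => (eval_oneBlock_eq_zero_iff h𝔭 hhom hunm u).mp hu)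
  refine ⟨c, hc, fun i => β (Fin.cast hdeg.symm i), fun i => hβ _, heq.trans ?_⟩
  congr 1
  exact Fintype.prod_equiv (finCongr hdeg) _ _ (fun i => by simp)

/-- A zero of `𝔭` is proportional to one of the points of ANY splitting `g = c ∏ ℓ_{γᵢ}` of the
one-block form into linear forms (`ℓ_β̄` is a prime divisor of `g`). [folklore] -/
theorem exists_eq_smul_of_split (h𝔭 : 𝔭.IsPrime)
    (hhom : letI := MvPolynomial.gradedAlgebra (σ := Fin (m + 1)) (R := ℚ);
      𝔭.IsHomogeneous (homogeneousSubmodule (Fin (m + 1)) ℚ)) (hunm : IsUnmixedOfRank 𝔭 1)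
    {ι : Type*} [Fintype ι] {c : ℂ} {γ : ι → Fin (m + 1) → ℂ} (hγ : ∀ i, γ i ≠ 0)
    (heq : rename Prod.snd (map (algebraMap ℚ ℂ) (chowForm 𝔭 1)) = C c * ∏ i, (∑ j, C (γ i j) * X j))
    {β : Fin (m + 1) → ℂ} (hβ : β ∈ projZeros 𝔭) : ∃ (i : ι) (l : ℂ), β = l • γ i := by
  classical
  have hβ0 : β ≠ 0 := hβ.1
  have hdvd : ((∑ j, C (β j) * X j) : MvPolynomial (Fin (m + 1)) ℂ) ∣
      rename Prod.snd (map (algebraMap ℚ ℂ) (chowForm 𝔭 1)) :=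
    linC_dvd_of_forall_eval hβ0 fun u hu =>
      (eval_oneBlock_eq_zero_iff h𝔭 hhom hunm u).mpr ⟨β, hβ, hu⟩
  rw [heq] at hdvd
  have hp := prime_linC hβ0
  rcases hp.dvd_or_dvd hdvd with h1 | h1
  · exfalso
    obtain ⟨hg0, -⟩ := oneBlock_facts h𝔭 hhom hunm
    have hc : c ≠ 0 := by
      rintro rfl
      rw [C_0, zero_mul] at heq
      exact hg0 heq
    exact hp.not_unit (isUnit_of_dvd_unit h1 ((IsUnit.mk0 c hc).map C))
  · obtain ⟨i, -, hi⟩ := hp.exists_mem_finset_dvd h1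
    obtain ⟨l, hl⟩ := eq_smul_of_linC_dvd_linC hβ0 (hγ i) hi
    -- `hl : γ i = l • β`, so `β = l⁻¹ • γ i`
    have hl0 : l ≠ 0 := by
      rintro rfl
      exact hγ i (by rw [hl, zero_smul])
    exact ⟨i, l⁻¹, by rw [hl, smul_smul, inv_mul_cancel₀ hl0, one_smul]⟩

/-- **No zero of `𝔭` lies on a coordinate hyperplane `x_j = 0` with `x_j ∉ 𝔭`** (the coefficient
`F(e_j)` of `u_j^{deg 𝔭}` in the associated form is non-zero, `aLead_chowForm_ne_zero`).
[cite: NesterenkoPhilippon2001, Ch. 3, remark after Prop. 4.4 (p. 38)] -/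
theorem apply_ne_zero_of_mem_projZeros (h𝔭 : 𝔭.IsPrime)
    (hhom : letI := MvPolynomial.gradedAlgebra (σ := Fin (m + 1)) (R := ℚ);
      𝔭.IsHomogeneous (homogeneousSubmodule (Fin (m + 1)) ℚ)) (hunm : IsUnmixedOfRank 𝔭 1)
    {j : Fin (m + 1)} (hj : (X j : Rx m) ∉ 𝔭) {β : Fin (m + 1) → ℂ} (hβ : β ∈ projZeros 𝔭) :
    β j ≠ 0 := by
  intro hβj
  obtain ⟨-, -, -, -, -, hmem⟩ := chowForm_facts h𝔭 hhom hunm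
  have ha := aLead_chowForm_ne_zero h𝔭 hhom (rank_eq_zero_add_one h𝔭 hunm) hj
  apply ha
  set lam0 : Fin 0 × Fin (m + 1) → ℚ := fun v => v.1.elim0 with hlam0
  have h := aeval_lastCases_eq_algebraMap_eval_aLead 0 j (chowForm 𝔭 1) lam0
  have hzero : aeval (fun v : Fin (0 + 1) × Fin (m + 1) =>
      Fin.lastCases (motive := fun _ => ℂ) (if v.2 = j then 1 else 0)
        (fun i => algebraMap ℚ ℂ (lam0 (i, v.2))) v.1) (chowForm 𝔭 1) = 0 := by
    refine aeval_eq_zero_of_mem_elimIdeal hmem hβ fun i => ?_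
    have hi : i = Fin.last 0 := Subsingleton.elim _ _
    subst hi
    simp only [Fin.lastCases_last, ite_mul, one_mul, zero_mul, Finset.sum_ite_eq', Finset.mem_univ,
      if_true]
    exact hβj
  rw [hzero] at h
  have h1 : eval lam0 (aLead 0 j (chowForm 𝔭 1)) = 0 := (algebraMap ℚ ℂ).injective (by
    rw [map_zero]; exact h.symm)
  rw [eq_C_of_isEmpty (aLead 0 j (chowForm 𝔭 1))] at h1 ⊢
  rw [eval_C] at h1
  rw [h1, C_0]

/-- `V(𝔭) ≠ ∅`: the associated form has positive degree, so vanishes at `u = 0`. [folklore] -/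
theorem projZeros_nonempty' (h𝔭 : 𝔭.IsPrime)
    (hhom : letI := MvPolynomial.gradedAlgebra (σ := Fin (m + 1)) (R := ℚ);
      𝔭.IsHomogeneous (homogeneousSubmodule (Fin (m + 1)) ℚ)) (hunm : IsUnmixedOfRank 𝔭 1) :
    (projZeros 𝔭).Nonempty := by
  obtain ⟨-, -, hghom, -⟩ := oneBlock_facts h𝔭 hhom hunm
  obtain ⟨-, -, -, hdeg, -⟩ := chowForm_facts h𝔭 hhom hunm
  have h0 : eval (0 : Fin (m + 1) → ℂ) (rename Prod.snd (map (algebraMap ℚ ℂ) (chowForm 𝔭 1))) = 0 := by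
    rw [MvPolynomial.eval_zero]
    change coeff 0 _ = 0
    exact hghom.coeff_eq_zero (by rw [map_zero]; omega)
  obtain ⟨β, hβ, -⟩ := (eval_oneBlock_eq_zero_iff h𝔭 hhom hunm 0).mp h0
  exact ⟨β, hβ⟩

end RankOne

/-! ## §2  The field of a normalised zero -/

section Field

variable {𝔭 : Ideal (Rx m)}

/-- A chart through a zero: if `b̄' ∈ V(𝔭)` has `b'_j = 1` then `x_j ∉ 𝔭`. [folklore] -/
theorem X_notMem_of_apply_eq_one {b' : Fin (m + 1) → ℂ} (hb' : b' ∈ projZeros 𝔭) {j : Fin (m + 1)}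
    (hj : b' j = 1) : (X j : Rx m) ∉ 𝔭 := fun h => by
  have := hb'.2 _ h
  rw [aeval_X, hj] at this
  exact one_ne_zero this

/-- **The coordinates of a normalised zero are algebraic.** For `b̄' ∈ V(𝔭)` with `b'_j = 1`, every
`b'_k` is integral over `ℚ`: `t ↦ F(t e_j + e_k)` is a rational polynomial vanishing at `−b'_k`
(zeros theorem), and it is not identically zero (it vanishes only when `t e_j + e_k` passes through
one of the finitely many points of `V(𝔭)`). [cite: NesterenkoPhilippon2001, Ch. 3 Prop. 4.4 (p. 38)] -/
theorem isIntegral_of_mem_projZeros (h𝔭 : 𝔭.IsPrime)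
    (hhom : letI := MvPolynomial.gradedAlgebra (σ := Fin (m + 1)) (R := ℚ);
      𝔭.IsHomogeneous (homogeneousSubmodule (Fin (m + 1)) ℚ)) (hunm : IsUnmixedOfRank 𝔭 1)
    {b' : Fin (m + 1) → ℂ} (hb' : b' ∈ projZeros 𝔭) {j : Fin (m + 1)} (hj : b' j = 1)
    (k : Fin (m + 1)) : IsIntegral ℚ (b' k) := by
  classical
  by_cases hkj : k = j
  · rw [hkj, hj]; exact isIntegral_one
  obtain ⟨hpr, -, -, -, -, hmem⟩ := chowForm_facts h𝔭 hhom hunm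
  have hXj := X_notMem_of_apply_eq_one hb' hj
  -- the rational polynomial `q(t) = F(t e_j + e_k)`
  set w : Fin 1 × Fin (m + 1) → Polynomial ℚ := fun v =>
    if v.2 = j then Polynomial.X else Polynomial.C (if v.2 = k then 1 else 0) with hw
  set q : Polynomial ℚ := aeval w (chowForm 𝔭 1) with hq
  have hqt : ∀ t : ℂ, Polynomial.aeval t q =
      aeval (fun v : Fin 1 × Fin (m + 1) => if v.2 = j then t else if v.2 = k then 1 else 0)
        (chowForm 𝔭 1) := by
    intro t
    have h := congrArg (fun φ : RU 1 m →ₐ[ℚ] ℂ => φ (chowForm 𝔭 1))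
      (comp_aeval (R := ℚ) (f := w) (Polynomial.aeval t))
    simp only [AlgHom.comp_apply] at h
    rw [hq, h]
    refine congrArg (fun f => aeval f (chowForm 𝔭 1)) (funext fun v => ?_)
    simp only [hw]
    split_ifs <;> simp
  -- the line `t e_j + e_k` through `b̄'` : `∑ⱼ' u_{j'} b'_{j'} = t + b'_k`
  have hsum : ∀ (t : ℂ) (β : Fin (m + 1) → ℂ),
      ∑ j', (if j' = j then t else if j' = k then (1 : ℂ) else 0) * β j' = t * β j + β k := by
    intro t β
    have e : ∀ j', (if j' = j then t else if j' = k then (1 : ℂ) else 0) * β j' =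
        (if j' = j then t * β j' else 0) + (if j' = k then β j' else 0) := by
      intro j'
      by_cases h1 : j' = j
      · subst h1; simp [Ne.symm hkj]
      · by_cases h2 : j' = k
        · subst h2; simp [h1]
        · simp [h1, h2]
    simp_rw [e, Finset.sum_add_distrib, Finset.sum_ite_eq', Finset.mem_univ, if_true]
  -- `q(-b'_k) = 0`
  have hroot : Polynomial.aeval (-b' k) q = 0 := by
    rw [hqt]
    refine aeval_eq_zero_of_mem_elimIdeal hmem hb' fun i => ?_
    rw [hsum, hj]; ring
  -- `q ≠ 0`: pick a rational `t₀` off the finitely many bad values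
  obtain ⟨c, hc, γ, hγ, heq⟩ := exists_split_oneBlock h𝔭 hhom hunm
  have hγ0 : ∀ i, γ i ≠ 0 := fun i => (hγ i).1
  have hγj : ∀ i, γ i j ≠ 0 := fun i => apply_ne_zero_of_mem_projZeros h𝔭 hhom hunm hXj (hγ i)
  set bad : Finset ℂ := Finset.univ.image fun i => -(γ i k / γ i j) with hbad
  obtain ⟨t₀, ht₀⟩ := Infinite.exists_notMem_finset
    (bad.preimage (fun t : ℚ => (t : ℂ)) (Rat.cast_injective.injOn))
  rw [Finset.mem_preimage] at ht₀
  have hne : Polynomial.aeval ((t₀ : ℚ) : ℂ) q ≠ 0 := by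
    rw [hqt]
    intro h0
    obtain ⟨β, hβ, hβu⟩ := (aeval_chowForm_eq_zero_iff hhom hpr _).mp h0
    have h1 := hβu 0
    simp only at h1
    rw [hsum] at h1
    obtain ⟨i, l, rfl⟩ := exists_eq_smul_of_split h𝔭 hhom hunm hγ0 heq hβ
    have hl : l ≠ 0 := by
      rintro rfl
      exact hβ.1 (zero_smul _ _)
    apply ht₀
    rw [hbad, Finset.mem_image]
    refine ⟨i, Finset.mem_univ _, ?_⟩
    simp only [Pi.smul_apply, smul_eq_mul] at h1
    have h2 : (t₀ : ℂ) * γ i j + γ i k = 0 := by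
      have : l * ((t₀ : ℂ) * γ i j + γ i k) = 0 := by rw [← h1]; ring
      exact (mul_eq_zero.mp this).resolve_left hl
    rw [← neg_div]
    exact (eq_div_of_mul_eq (hγj i) (by linear_combination h2)).symm
  have hq0 : q ≠ 0 := fun h => hne (by rw [h, map_zero])
  have halg : IsAlgebraic ℚ (-b' k) := ⟨q, hq0, hroot⟩
  simpa using halg.isIntegral.neg

/-- The field `ℚ(b̄') ⊆ ℂ` of a normalised zero is finite-dimensional. [folklore] -/
theorem finiteDimensional_adjoin (h𝔭 : 𝔭.IsPrime)
    (hhom : letI := MvPolynomial.gradedAlgebra (σ := Fin (m + 1)) (R := ℚ);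
      𝔭.IsHomogeneous (homogeneousSubmodule (Fin (m + 1)) ℚ)) (hunm : IsUnmixedOfRank 𝔭 1)
    {b' : Fin (m + 1) → ℂ} (hb' : b' ∈ projZeros 𝔭) {j : Fin (m + 1)} (hj : b' j = 1) :
    FiniteDimensional ℚ ↥(IntermediateField.adjoin ℚ (Set.range b')) := by
  apply IntermediateField.finiteDimensional_adjoin
  rintro _ ⟨k, rfl⟩
  exact isIntegral_of_mem_projZeros h𝔭 hhom hunm hb' hj k

/-- Hence a number field. [folklore] -/
theorem numberField_adjoin (h𝔭 : 𝔭.IsPrime)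
    (hhom : letI := MvPolynomial.gradedAlgebra (σ := Fin (m + 1)) (R := ℚ);
      𝔭.IsHomogeneous (homogeneousSubmodule (Fin (m + 1)) ℚ)) (hunm : IsUnmixedOfRank 𝔭 1)
    {b' : Fin (m + 1) → ℂ} (hb' : b' ∈ projZeros 𝔭) {j : Fin (m + 1)} (hj : b' j = 1) :
    NumberField ↥(IntermediateField.adjoin ℚ (Set.range b')) :=
  haveI := finiteDimensional_adjoin h𝔭 hhom hunm hb' hj
  Literature.NumberTheory.Transcendental.NguyenRoy.NFPres.numberField_of_intermediateField _

end Field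

/-! ### The registered sub-goal of this helper file -/

/-- **Registered sub-goal `stub_zeroDimDictionary_zeros`** (crux `stmt-Schanuel-6117`, line
`orbit-interpolation-determinant`; the part of stub `stub_zeroDimDictionary` carried by this file):
a homogeneous prime of rank `1` has a normalised zero with algebraic coordinates.
[cite: NesterenkoPhilippon2001, Ch. 3 Prop. 4.4 (p. 38)] -/
theorem stub_zeroDimDictionary_zeros : ∀ (m : ℕ) (𝔭 : Ideal (Rx m)), 𝔭.IsPrime → (letI := MvPolynomial.gradedAlgebra (σ := Fin (m + 1)) (R := ℚ); 𝔭.IsHomogeneous (homogeneousSubmodule (Fin (m + 1)) ℚ)) → IsUnmixedOfRank 𝔭 1 → ∃ b' ∈ projZeros 𝔭, ∃ j : Fin (m + 1), b' j = 1 ∧ ∀ k, IsIntegral ℚ (b' k) := by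
  intro m 𝔭 h𝔭 hhom hunm
  obtain ⟨β₀, hβ₀⟩ := projZeros_nonempty' h𝔭 hhom hunm
  obtain ⟨j, hj0⟩ := Function.ne_iff.mp hβ₀.1
  have hb' : (β₀ j)⁻¹ • β₀ ∈ projZeros 𝔭 :=
    Literature.NumberTheory.Transcendental.PhilipponMain.smul_mem_projZeros
      (fun P hP k => homogeneousComponent_mem_of_mem hhom hP k) hβ₀ (inv_ne_zero hj0)
  have hj : ((β₀ j)⁻¹ • β₀) j = 1 := by
    rw [Pi.smul_apply, smul_eq_mul, inv_mul_cancel₀ hj0]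
  exact ⟨_, hb', j, hj, isIntegral_of_mem_projZeros h𝔭 hhom hunm hb' hj⟩

end Summit.Schanuel.Schanuel.Cruxes.ApproximationProperty.OrbitInterpolationDeterminant

end
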